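import Literature.MathematicalPhysics.QuantumFieldTheory.King1986.TorusBlockForm

/-!
# `Balaban1983to89.B5Eq129FreeResolventSupBound` — T. Bałaban, *Propagators and renormalization transformations for lattice gauge theories. I*, Commun.
# Math. Phys. **95** (1984) 17–40 [Balaban1984PropagatorsI] (1.29) p. 23 (the momentum representation on the torus `T′_η`), (1.31) p. 23 (the symbol
# `Δ(p) = Σ_μ|∂_μ(p)|²`, `∂_μ(p) = (e^{iηp_μ} − 1)∕η`), Prop. 1.1 p. 33 («γ₀ independent of k, T_η, and depending on d only»): **THE SUP NORM OF THE DOUBLE FREE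
# RESOLVENT FROM THE `L²` SIZE OF THE DATA — `|((−Δ^η + m)⁻²ψ)(x)| ≤ C₃·‖ψ‖_{ℓ²}` ON THE FINITE TORUS WITH THE SPECTRAL CONSTANT
# `C₃² = |T|⁻¹·Σ_{p∈T̃} (Δ(p) + m)⁻⁴` — Fourier inversion, Plancherel, the shift multipliers `e^{±ip·e_ν}` and one Cauchy–Schwarz** — the FLAT SCALAR LETTER
# (FS) of the pub-balaban NE9 owner's SUP-NORM PROGRAMME (plan v10, stone (FS-a); the zone-sum bound of `C₃` in d ≤ 4 is stone (FS-b))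

statement-level skeleton of published theorems with citation tags; proofs where landed; nothing here is a claim about the Yang–Mills mass gap

CITATION HEADER (lean-in-tree rule).  Audit cell `pub-balaban`, sub-cell `t4`, BINDER row NE9; filed by the row OWNER lineage `b2b-balaban-t4-ne9-p1` (gen 89).
Source [Balaban1984PropagatorsI] as quoted VERBATIM in the header of the imported `B5Prop11Plancherel` (renders `b2b-balaban-ref1/pages/1984-cmp95-propagators-rt-I/`):
p. 23 (1.29) *«The momentum representation on an arbitrary torus T′_η … is introduced by the Fourier transform f̃(p) = Σ_{x∈T′_η} η^d e^{−ip·x} f(x), p ∈ T̃′_η,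
f(x) = (2π)^{−d} Σ_{p∈T̃′_η} (Π_{μ=1}^{d} π∕L′_μ) e^{ix·p} f̃(p)»*; (1.31) *«Δ(p) = Σ_{μ=1}^{d} |∂_μ(p)|², ∂_μ(p) = (e^{iηp_μ} − 1)∕η»*; p. 33 Prop. 1.1 *«… with a
positive constant γ₀ independent of k, T_η, and depending on d only»*.  The characters `chi N p x = Π_μ e^{2πi p_μx_μ∕N_μ}`, their orthogonality `sum_chi`
and the shift rule `chi_add_right` are `B5Prop11Plancherel`'s (pub-balaban node T02.1); the unnormalised transform of a REAL lattice function
`ft N φ p = Σ_y φ(y)·conj χ_p(y)`, its INVERSION `Σ_p φ̂(p)χ_p(x) = |T|·φ(x)` and PARSEVAL `Σ_p|φ̂(p)|² = |T|Σ_yφ(y)²` are `King1986.Torus.ft ∕ inversion ∕ parseval`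
(C. King, CMP 103 (1986) (4.35), the tree's `King1986/TorusBlockForm`, [folklore] Fourier toolkit on the same characters) — ALL USED BY NAME; the normalisations
`η^d`, `(2π)^{−d}Ππ∕L′_μ` of (1.29) multiply to `|T|⁻¹` (same content).  No `def` here.

WHY THIS FILE (cell context; owner plan v10, journal [NE9P1-G89-ONLINE]∕[NE9P1-G89-STAGED2]).  `B9Eq342SupNormBootstrap.norm_le_of_kato_bootstrap` bounds the sup
norm of a covariant Green's function by its energy size, Kato domination used twice, modulo ONE displayed scalar letter (FS): for the FLAT weighted graph
Laplacian `L₀` and `0 < m`, `(L₀+m)φ₁ = ψ ≥ 0`, `(L₀+m)φ₂ = φ₁ ⟹ φ₂(x) ≤ C₃·√(Σ_y c(y)ψ(y)²)`.  THIS file proves (FS) for the free lattice Laplacian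
`(L₀φ)(x) = Σ_ν t²[(φ(x) − φ(x−e_ν)) + (φ(x) − φ(x+e_ν))]` on the finite torus `Π_μ ℤ∕N_μ` with the SPECTRAL constant `C₃² = |T|⁻¹Σ_p(Δ_t(p) + m)⁻⁴`,
`Δ_t(p) = Σ_ν t²(2 − 2Re e^{2πip_ν∕N_ν})` (every `d`, every `t`, every torus); the LEVEL-FREE bound of that constant in d ≤ 4 at the diagonal `N_μ = M_μ·t`
(`C₃² ≤ c₁⁻¹·K(d, m)`, the UV-convergence of `∫d⁴p∕(p² + m)⁴`) is the next stone (FS-b), and the transport to the chain's carrier `TSite d P` with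
`B9SectCLatticeCarrier.shift∕unshift` the one after.

WHAT IS PROVED (sorry-free; 0 `def`; [folklore] finite Fourier analysis BY NAME on `B5Prop11Plancherel`'s characters and `King1986.Torus.ft`).
* §1 `re_chi_le_one`, `norm_ft_mul_chi`; **`ft_shift_add`** ∕ **`ft_shift_sub`** (`(φ(· ± e))^(p) = χ_p(±e)^{∓}·φ̂(p)` — shifts are multipliers), **`ft_laplace`**
  (the flat Laplacian is the multiplier `Δ_t(p) = Σ_ν t²(2 − 2Re χ_p(e_ν)) ≥ 0`, `symbol_nonneg`), `ft_resolvent` (`(L₀+m)φ = ψ ⟹ (Δ_t(p)+m)·φ̂(p) = ψ̂(p)`).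
* §2 **`abs_le_of_double_resolvent`** — THE LETTER (FS-a): `(L₀+m)φ₁ = ψ`, `(L₀+m)φ₂ = φ₁`, `0 < m` ⟹
  `|φ₂(x)| ≤ √(|T|⁻¹Σ_p (Δ_t(p)+m)⁻⁴)·√(Σ_y ψ(y)²)` for real lattice functions; **`le_of_double_resolvent_weighted`** — the same against the weighted size
  `√(Σ_y c₀ψ(y)²)` with the constant `√((c₀|T|)⁻¹Σ_p(Δ_t(p)+m)⁻⁴)` (print's `η^d`-weighted `L²`, (3.11) of [Balaban1985BackgroundPropagators]).
HONEST SCOPE.  Free (`U = 1`) scalar lattice Laplacian only; the constant is DISPLAYED in spectral form — its lattice-uniform bound is NOT in this file;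
classical Fourier analysis, nothing of B5's (1.83)–(1.89) machinery.  NOT summit progress (cell pub-balaban: NE9 NOT PRINTED ∕ NOT PROVED; «NE9 ⇐ the named
binders»; row WALLED ON A MODEL (O-NE9-1; #5 UNRULED); spine PROVED 0∕9; rung (B)+1 finite T⁴ — NOT infinite volume, NOT mass gap, NOT BetaPertH, NOT Clay).
HONEST DEPENDENCY (cell line): continuum YM on T⁴ ⇐ BetaPertH ∧ nine spine estimates (0/9 proved); BetaPertH ⇐ (D1) ∧ (D4) ∧ CAP+tail; G-an2-4 gates asym,
D1 and NE2/3/4.  NEW file importing `King1986.TorusBlockForm` (⊇ `B5Prop11Plancherel`) only; nothing modified.  Net new unproved facts: 0.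
-/

noncomputable section

open scoped ComplexConjugate BigOperators

namespace Literature.MathematicalPhysics.QuantumFieldTheory.Balaban1983to89.B5Eq129FreeResolventSupBound

open B5Prop11Plancherel (Tor chi unitVec sum_chi chi_add_left chi_add_right chi_zero_left conj_chi chi_unitVec chi_neg_neg)
open Literature.MathematicalPhysics.QuantumFieldTheory.King1986.Torus (ft chi_comm chi_neg_left chi_mul_conj_chi sum_chi_left parseval inversion)

variable {d : ℕ} (N : Fin d → ℕ) [∀ μ, NeZero (N μ)]

/-! ## §1 Shifts and the flat Laplacian are Fourier multipliers (for `ft N φ p = Σ_y φ(y)·conj χ_p(y)` of a real `φ`) -/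

/-- `Re e^{ip·x} ≤ 1` (`|e^{ip·x}| = 1` factorwise). [cite: Balaban1984PropagatorsI, (1.29) p.23] -/
theorem re_chi_le_one (p x : Tor N) : (chi N p x).re ≤ 1 := by
  have h : ‖chi N p x‖ = 1 := by
    unfold chi
    rw [norm_prod]
    exact Finset.prod_eq_one fun μ _ => by rw [ZMod.stdAddChar_apply, Circle.norm_coe]
  exact (Complex.re_le_norm _).trans_eq h

/-- `‖z·e^{ip·x}‖ = ‖z‖`. [cite: Balaban1984PropagatorsI, (1.29) p.23] -/
theorem norm_mul_chi (z : ℂ) (p x : Tor N) : ‖z * chi N p x‖ = ‖z‖ := by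
  have h : ‖chi N p x‖ = 1 := by
    unfold chi
    rw [norm_prod]
    exact Finset.prod_eq_one fun μ _ => by rw [ZMod.stdAddChar_apply, Circle.norm_coe]
  rw [norm_mul, h, mul_one]

/-- `(φ(· + e))^(p) = χ_p(e)·φ̂(p)`: translation is a Fourier multiplier. [cite: Balaban1984PropagatorsI, (1.31) p.23] -/
theorem ft_shift_add (φ : Tor N → ℝ) (e p : Tor N) : ft N (fun y => φ (y + e)) p = chi N p e * ft N φ p := by
  unfold ft
  rw [Finset.mul_sum]
  rw [← Fintype.sum_equiv (Equiv.subRight e) (fun z => (φ z : ℂ) * conj (chi N p (z - e))) (fun y => (φ (y + e) : ℂ) * conj (chi N p y))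
    (fun z => by simp [sub_add_cancel])]
  refine Finset.sum_congr rfl fun z _ => ?_
  rw [sub_eq_add_neg, chi_add_right, map_mul, conj_chi N p (-e), chi_neg_neg]
  ring

/-- `(φ(· − e))^(p) = conj χ_p(e)·φ̂(p)`. [cite: Balaban1984PropagatorsI, (1.31) p.23] -/
theorem ft_shift_sub (φ : Tor N → ℝ) (e p : Tor N) : ft N (fun y => φ (y - e)) p = conj (chi N p e) * ft N φ p := by
  simp_rw [sub_eq_add_neg]
  rw [ft_shift_add, conj_chi, chi_neg_left]

/-- The symbol of the flat Laplacian is nonnegative: `0 ≤ Σ_ν t²(2 − 2Re χ_p(e_ν))`. [cite: Balaban1984PropagatorsI, (1.31) p.23] -/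
theorem symbol_nonneg (t : ℝ) (p : Tor N) : 0 ≤ ∑ ν, t ^ 2 * (2 - 2 * (chi N p (unitVec N ν)).re) :=
  Finset.sum_nonneg fun ν _ => mul_nonneg (sq_nonneg t) (by have h := re_chi_le_one N p (unitVec N ν); linarith)

/-- **THE FLAT LAPLACIAN IS THE FOURIER MULTIPLIER `Δ_t(p) = Σ_ν t²(2 − 2Re χ_p(e_ν))`**: for `(L₀φ)(y) = Σ_ν t²[(φ(y) − φ(y−e_ν)) + (φ(y) − φ(y+e_ν))]`,
`(L₀φ)^(p) = Δ_t(p)·φ̂(p)` — (1.31)'s `Δ(p) = Σ|∂_μ(p)|²` (`|e^{iθ} − 1|² = 2 − 2cos θ`). [cite: Balaban1984PropagatorsI, (1.31) p.23] -/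
theorem ft_laplace (t : ℝ) (φ : Tor N → ℝ) (p : Tor N) :
    ft N (fun y => ∑ ν, t ^ 2 * ((φ y - φ (y - unitVec N ν)) + (φ y - φ (y + unitVec N ν)))) p =
      ((∑ ν, t ^ 2 * (2 - 2 * (chi N p (unitVec N ν)).re) : ℝ) : ℂ) * ft N φ p := by
  have hsub : ∀ ν, ft N (fun y => φ (y - unitVec N ν)) p = conj (chi N p (unitVec N ν)) * ft N φ p := fun ν => ft_shift_sub N φ _ p
  have hadd : ∀ ν, ft N (fun y => φ (y + unitVec N ν)) p = chi N p (unitVec N ν) * ft N φ p := fun ν => ft_shift_add N φ _ p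
  calc ft N (fun y => ∑ ν, t ^ 2 * ((φ y - φ (y - unitVec N ν)) + (φ y - φ (y + unitVec N ν)))) p
      = ∑ ν, (t ^ 2 : ℂ) * ((ft N φ p - ft N (fun y => φ (y - unitVec N ν)) p) + (ft N φ p - ft N (fun y => φ (y + unitVec N ν)) p)) := by
        unfold ft
        push_cast
        simp_rw [Finset.sum_mul]
        rw [Finset.sum_comm]
        refine Finset.sum_congr rfl fun ν _ => ?_
        rw [← Finset.sum_sub_distrib, ← Finset.sum_sub_distrib, ← Finset.sum_add_distrib, Finset.mul_sum]
        exact Finset.sum_congr rfl fun y _ => by ring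
    _ = ∑ ν, (t ^ 2 : ℂ) * ((1 - conj (chi N p (unitVec N ν))) + (1 - chi N p (unitVec N ν))) * ft N φ p := by
        refine Finset.sum_congr rfl fun ν _ => ?_
        rw [hsub, hadd]
        ring
    _ = ((∑ ν, t ^ 2 * (2 - 2 * (chi N p (unitVec N ν)).re) : ℝ) : ℂ) * ft N φ p := by
        rw [← Finset.sum_mul]
        congr 1
        push_cast
        refine Finset.sum_congr rfl fun ν _ => ?_
        have h : (1 - conj (chi N p (unitVec N ν))) + (1 - chi N p (unitVec N ν)) = ((2 - 2 * (chi N p (unitVec N ν)).re : ℝ) : ℂ) := by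
          have hc := Complex.add_conj (chi N p (unitVec N ν))
          push_cast at hc ⊢
          linear_combination (-1 : ℂ) * hc
        rw [h]
        push_cast
        ring

/-- The resolvent equation in Fourier space: `(L₀+m)φ = ψ ⟹ (Δ_t(p) + m)·φ̂(p) = ψ̂(p)`. [cite: Balaban1984PropagatorsI, (1.31) p.23] -/
theorem ft_resolvent (t m : ℝ) {φ ψ : Tor N → ℝ}
    (h : ∀ x, ∑ ν, t ^ 2 * ((φ x - φ (x - unitVec N ν)) + (φ x - φ (x + unitVec N ν))) + m * φ x = ψ x) (p : Tor N) :
    ((∑ ν, t ^ 2 * (2 - 2 * (chi N p (unitVec N ν)).re) + m : ℝ) : ℂ) * ft N φ p = ft N ψ p := by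
  have hL := ft_laplace N t φ p
  have hψ : ft N ψ p = ft N (fun y => ∑ ν, t ^ 2 * ((φ y - φ (y - unitVec N ν)) + (φ y - φ (y + unitVec N ν)))) p + (m : ℂ) * ft N φ p := by
    unfold ft
    rw [Finset.mul_sum, ← Finset.sum_add_distrib]
    refine Finset.sum_congr rfl fun y _ => ?_
    rw [← h y]
    push_cast
    ring
  rw [hψ, hL]
  push_cast
  ring

/-! ## §2 The sup norm of the double resolvent from the `ℓ²` size of the data -/

/-- **(FS-a) THE SUP NORM OF THE DOUBLE FREE RESOLVENT**: on the finite torus, for real `t`, `0 < m` and real lattice functions with `(L₀+m)φ₁ = ψ`,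
`(L₀+m)φ₂ = φ₁` (`L₀` the flat Laplacian with weight `t²`): `|φ₂(x)| ≤ √(|T|⁻¹·Σ_p (Δ_t(p)+m)⁻⁴)·√(Σ_y ψ(y)²)` — Fourier inversion, `φ̂₂ = ψ̂∕(Δ_t+m)²`,
Cauchy–Schwarz over momenta, Plancherel. [cite: Balaban1984PropagatorsI, (1.29) p.23, Prop. 1.1 p.33] -/
theorem abs_le_of_double_resolvent (t : ℝ) {m : ℝ} (hm : 0 < m) {ψ φ₁ φ₂ : Tor N → ℝ}
    (h₁ : ∀ x, ∑ ν, t ^ 2 * ((φ₁ x - φ₁ (x - unitVec N ν)) + (φ₁ x - φ₁ (x + unitVec N ν))) + m * φ₁ x = ψ x)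
    (h₂ : ∀ x, ∑ ν, t ^ 2 * ((φ₂ x - φ₂ (x - unitVec N ν)) + (φ₂ x - φ₂ (x + unitVec N ν))) + m * φ₂ x = φ₁ x) (x : Tor N) :
    |φ₂ x| ≤ Real.sqrt ((∑ p : Tor N, ((∑ ν, t ^ 2 * (2 - 2 * (chi N p (unitVec N ν)).re) + m) ^ 4)⁻¹) / Fintype.card (Tor N)) *
      Real.sqrt (∑ y, ψ y ^ 2) := by
  classical
  -- notation-free abbreviations
  set σ : Tor N → ℝ := fun p => (∑ ν, t ^ 2 * (2 - 2 * (chi N p (unitVec N ν)).re)) + m with hσ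
  have hσpos : ∀ p, 0 < σ p := fun p => add_pos_of_nonneg_of_pos (symbol_nonneg N t p) hm
  -- `φ̂₂(p) = ψ̂(p) / σ(p)²`
  have hF : ∀ p, ft N φ₂ p = ft N ψ p / ((σ p : ℂ) ^ 2) := by
    intro p
    have e₁ := ft_resolvent N t m h₁ p
    have e₂ := ft_resolvent N t m h₂ p
    have hσ0 : (σ p : ℂ) ≠ 0 := by exact_mod_cast (hσpos p).ne'
    rw [eq_div_iff (pow_ne_zero 2 hσ0), ← e₁, ← e₂]
    simp only [hσ]
    ring
  -- inversion: `|T| φ₂ x = Σ_p φ̂₂(p) χ_p(x)`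
  have hcard : (0 : ℝ) < Fintype.card (Tor N) := by exact_mod_cast Fintype.card_pos
  have hinv := inversion N φ₂ x
  have hbound : (Fintype.card (Tor N) : ℝ) * |φ₂ x| ≤ ∑ p : Tor N, (σ p ^ 2)⁻¹ * ‖ft N ψ p‖ := by
    have h1 : (Fintype.card (Tor N) : ℝ) * |φ₂ x| = ‖∑ p : Tor N, ft N φ₂ p * chi N p x‖ := by
      rw [hinv, norm_mul, Complex.norm_natCast, Complex.norm_real, Real.norm_eq_abs]
    rw [h1]
    refine (norm_sum_le _ _).trans (Finset.sum_le_sum fun p _ => ?_)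
    rw [norm_mul_chi, hF p, norm_div, norm_pow, Complex.norm_real, Real.norm_eq_abs, abs_of_pos (hσpos p), div_eq_inv_mul]
  -- Cauchy–Schwarz over momenta and Parseval
  have hCS : (∑ p : Tor N, (σ p ^ 2)⁻¹ * ‖ft N ψ p‖) ^ 2 ≤ (∑ p : Tor N, ((σ p ^ 2)⁻¹) ^ 2) * ∑ p : Tor N, ‖ft N ψ p‖ ^ 2 :=
    Finset.sum_mul_sq_le_sq_mul_sq _ _ _
  have hPl : ∑ p : Tor N, ‖ft N ψ p‖ ^ 2 = (Fintype.card (Tor N) : ℝ) * ∑ y, ψ y ^ 2 := parseval N ψ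
  have hS : ∑ p : Tor N, ((σ p ^ 2)⁻¹) ^ 2 = ∑ p : Tor N, (σ p ^ 4)⁻¹ :=
    Finset.sum_congr rfl fun p _ => by rw [← inv_pow, ← pow_mul]; norm_num
  rw [hPl, hS] at hCS
  -- assemble: `|T|·|φ₂ x| ≤ √S·√(|T| Σψ²)`
  have hA : 0 ≤ ∑ p : Tor N, (σ p ^ 4)⁻¹ := Finset.sum_nonneg fun p _ => by positivity
  have hB : 0 ≤ ∑ y, ψ y ^ 2 := Finset.sum_nonneg fun y _ => sq_nonneg _
  have hsum0 : 0 ≤ ∑ p : Tor N, (σ p ^ 2)⁻¹ * ‖ft N ψ p‖ := Finset.sum_nonneg fun p _ => by positivity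
  have h2 : ∑ p : Tor N, (σ p ^ 2)⁻¹ * ‖ft N ψ p‖ ≤ Real.sqrt (∑ p : Tor N, (σ p ^ 4)⁻¹) * Real.sqrt ((Fintype.card (Tor N) : ℝ) * ∑ y, ψ y ^ 2) := by
    rw [← Real.sqrt_mul hA, ← Real.sqrt_sq hsum0]
    exact Real.sqrt_le_sqrt hCS
  have h3 : |φ₂ x| ≤ Real.sqrt (∑ p : Tor N, (σ p ^ 4)⁻¹) * Real.sqrt ((Fintype.card (Tor N) : ℝ) * ∑ y, ψ y ^ 2) / Fintype.card (Tor N) := by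
    rw [le_div_iff₀ hcard, mul_comm]; exact hbound.trans h2
  refine h3.trans (le_of_eq ?_)
  rw [Real.sqrt_mul hcard.le, Real.sqrt_div hA, div_eq_mul_inv]
  have hc : Real.sqrt (Fintype.card (Tor N) : ℝ) ≠ 0 := (Real.sqrt_pos.2 hcard).ne'
  field_simp
  rw [Real.sq_sqrt hcard.le]
  ring

/-- **(FS-a) AGAINST THE WEIGHTED `L²` SIZE** (print's `η^d`-weights, constant weight `c₀ > 0`): under the same hypotheses
`φ₂(x) ≤ √((c₀|T|)⁻¹·Σ_p(Δ_t(p)+m)⁻⁴)·√(Σ_y c₀ψ(y)²)` — the shape of the letter `hFS` of `B9Eq342SupNormBootstrap.norm_le_of_kato_bootstrap`.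
[cite: Balaban1984PropagatorsI, (1.29) p.23, Prop. 1.1 p.33; Balaban1985BackgroundPropagators, (3.11) p.392] -/
theorem le_of_double_resolvent_weighted (t : ℝ) {m c₀ : ℝ} (hm : 0 < m) (hc₀ : 0 < c₀) {ψ φ₁ φ₂ : Tor N → ℝ}
    (h₁ : ∀ x, ∑ ν, t ^ 2 * ((φ₁ x - φ₁ (x - unitVec N ν)) + (φ₁ x - φ₁ (x + unitVec N ν))) + m * φ₁ x = ψ x)
    (h₂ : ∀ x, ∑ ν, t ^ 2 * ((φ₂ x - φ₂ (x - unitVec N ν)) + (φ₂ x - φ₂ (x + unitVec N ν))) + m * φ₂ x = φ₁ x) (x : Tor N) :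
    φ₂ x ≤ Real.sqrt ((∑ p : Tor N, ((∑ ν, t ^ 2 * (2 - 2 * (chi N p (unitVec N ν)).re) + m) ^ 4)⁻¹) / (c₀ * Fintype.card (Tor N))) *
      Real.sqrt (∑ y, c₀ * ψ y ^ 2) := by
  have h := (le_abs_self _).trans (abs_le_of_double_resolvent N t hm h₁ h₂ x)
  refine h.trans (le_of_eq ?_)
  have hA : 0 ≤ ∑ p : Tor N, (((∑ ν, t ^ 2 * (2 - 2 * (chi N p (unitVec N ν)).re)) + m) ^ 4)⁻¹ :=
    Finset.sum_nonneg fun p _ => inv_nonneg.2 (pow_nonneg (add_pos_of_nonneg_of_pos (symbol_nonneg N t p) hm).le _)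
  have hB : 0 ≤ ∑ y, ψ y ^ 2 := Finset.sum_nonneg fun y _ => sq_nonneg _
  have hcard : (0 : ℝ) < Fintype.card (Tor N) := by exact_mod_cast Fintype.card_pos
  rw [← Finset.mul_sum, ← Real.sqrt_mul (div_nonneg hA hcard.le), ← Real.sqrt_mul (div_nonneg hA (mul_pos hc₀ hcard).le)]
  congr 1
  field_simp

end Literature.MathematicalPhysics.QuantumFieldTheory.Balaban1983to89.B5Eq129FreeResolventSupBound

end
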